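import Literature.MathematicalPhysics.QuantumFieldTheory.Balaban1983to89.B5Momentum166Zd
import Summits.QuantumFields.BalabanUV.Beta.FP.PuncturedCoordDeriv

/-!
# `BalabanUV.Beta.FP.BrillouinRadial` — road «FP» for binder row D1, horizontal route H′ (owner ruling R-FP-17,
# `HOME/b2b-balaban-beta-d1-p3/OWNER-RULINGS-FP-5.md`), row **H2-P-RAD** of `LEAVES-FP.md`, RE-SCOPED per the owner's line of 2026-08-20T19:22:19Z
# («re-scope H2-P-RAD to the three NAMED instances + the Euclidean-norm variant importing leaf-05-g34's §3»): the radial powers `‖s‖^{-a}`,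
# `a < d + 1`, are Lebesgue integrable on the real Brillouin zone `BZ (d+1) = [-π,π]^{d+1}` (`B4ContourShift.BZ`) — sup norm AND Euclidean
# radius `√(Σ_i s_i²)` —, as COROLLARIES BY NAME of the tool of record `PuncturedCoordDeriv.integrableOn_BZ_of_norm_le_mul_norm_rpow_neg`
# (leaf-05-g34, p233319), with the three road instances `a = 1, 2, 3` at `d + 1 = 4` as named lemmas (the letter «`|s|⁻³ ∈ L¹(BZ 4)`» of rows
# H2-P-KER ∕ H2-P-B: three one-dimensional integrations by parts) and the natural-power ∕ Euclidean consumer forms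

HONEST DEPENDENCY (page 1, mandatory): continuum YM on T⁴ ⇐ BetaPertH ∧ nine spine estimates (0/9 proved); BetaPertH ⇐ (D1) ∧ (D4) ∧ CAP+tail;
G-an2-4 gates asym, D1 and NE2/3/4.  HONEST FRAMING (cell contract, verbatim): «discharging `BetaPertH` makes Bałaban's UV stability UNCONDITIONAL —
a real constructive-QFT result; it is NOT the continuum limit and NOT the Clay problem.»  THIS MODULE DISCHARGES NOTHING of the wall: [folklore]
Lebesgue integrability of radial powers on a bounded box in `ℝ^{d+1}` (polar coordinates = Mathlib's `MeasureTheory.integrableOn_ball_of_norm_le_rpow`,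
through leaf-05-g34's punctured-zone lemma BY NAME), on the road's momentum space `Fin (d+1) → ℝ` (sup norm) and for the Euclidean radius `√(Σ_i s_i²)`
(the spelling of `B4ContourShift.latticeKernel_decay_euclid`).  No `def`, no `def … : Prop`, nothing cited as a hypothesis, 0 sorry; 0 estimates of any
Bałaban object; 0 wall binders; NOT H2-P-KER, NOT hasym, NOT D1, NOT BetaPertH, NOT continuum, NOT Clay.  «not in print; our bookkeeping».

ABSOLUTE RULE (cell charter, verbatim): «No internally-minted statement may enter as a cited fact. Every hypothesis is either kernel-proved in this package or a
verbatim quotation of a PUBLISHED theorem with page reference. The manuscript(s) under audit are NOT citable for their own disputed steps — they are the thing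
under adjudication; programme-internal (2001/route/tribunal) claims are never citable.»

WHAT (all [folklore]; `measurableSet_BZ` ∕ `isCompact_BZ` are `B5Momentum166Zd`'s and `BZ_subset_ball` is `PuncturedCoordDeriv`'s, BY NAME).
* §1 THE ZONE: `norm_le_pi_of_mem_BZ` (`‖s‖_∞ ≤ π` on the zone), `zero_mem_BZ`, and the origin is Lebesgue-null: `BZ_diff_zero_ae_eq :
  BZ (d+1) ∖ {0} =ᵐ BZ (d+1)`.
* §2 SUP NORM: **`integrableOn_norm_rpow_neg_BZ (ha : a < d + 1) : IntegrableOn (fun s : Fin (d+1) → ℝ => ‖s‖ ^ (-a)) (BZ (d+1))`** (leaf-05's lemma at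
  `f := ‖·‖^{-a}`, `C := 1`); the natural-power form **`integrableOn_inv_norm_pow_BZ (hk : k ≤ d)`** (`(‖s‖^k)⁻¹`); the road instances at `d + 1 = 4`:
  **`integrableOn_inv_norm_BZ_four`** (`‖s‖⁻¹`), **`integrableOn_inv_norm_sq_BZ_four`** (`(‖s‖²)⁻¹`, the majorant of
  `PerfectPropagatorBound.norm_PinfSym_d1Sym_le_inv_norm_sq`), **`integrableOn_inv_norm_cube_BZ_four`** (`(‖s‖³)⁻¹`), and the real-exponent spellings
  `integrableOn_norm_rpow_neg_one/_two/_three_BZ_four`.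
* §3 CONSUMER FORMS (corollaries of leaf-05's lemma): natural-power form **`integrableOn_BZ_of_norm_le_div_norm_pow`** (`f` continuous on `BZ (d+1) ∖ {0}`,
  `‖f s‖ ≤ C/‖s‖^k` there, `k ≤ d`, `0 ≤ C` ⇒ `f ∈ L¹(BZ (d+1))`).
* §4 EUCLIDEAN VARIANT: `abs_apply_le_euclid`, `norm_le_euclid : ‖s‖_∞ ≤ √(Σ_i s_i²)`, `euclid_le_sqrt_card_mul_norm : √(Σ_i s_i²) ≤ √(d+1)·‖s‖_∞`,
  `euclid_pos`, `continuous_euclid`, **`integrableOn_euclid_rpow_neg_BZ (ha : a < d + 1) : IntegrableOn (fun s => √(Σ_i s_i²) ^ (-a)) (BZ (d+1))`**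
  (leaf-05's lemma with the majorant `√Σ^{-a} ≤ ‖s‖_∞^{-a}` for `0 ≤ a`; continuity on the compact zone for `a < 0`), `integrableOn_inv_euclid_pow_BZ
  (hk : k ≤ d)`, and at `d + 1 = 4`: `integrableOn_inv_euclid_BZ_four` (`(√Σ)⁻¹`), **`integrableOn_inv_sum_sq_BZ_four`** (`(Σ_i s_i²)⁻¹`),
  `integrableOn_inv_euclid_cube_BZ_four`; consumer form **`integrableOn_BZ_of_norm_le_div_euclid_pow`** (`‖f s‖ ≤ C/√(Σ_i s_i²)^k`, `k ≤ d`).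
Provenance: G-an2-4 swarm leaf prover 03, gen 42 (prover-b2b-balaban-gan24-formalise-leaf-03-g42-0), cross-lane on road FP (journal CLAIM «H2-P-RAD»
2026-08-20T19:20:39Z; owner re-scope 19:22:19Z), 2026-08-20.
-/

noncomputable section

namespace Summit.QuantumFields.BalabanUV.Beta.FP.BrillouinRadial

open MeasureTheory Filter Topology Set
open scoped BigOperators
open Literature.MathematicalPhysics.QuantumFieldTheory.Balaban1983to89
open B4ContourShift (BZ)
open B5Momentum166Zd (measurableSet_BZ isCompact_BZ)
open Summit.QuantumFields.BalabanUV.Beta.FP.PuncturedCoordDeriv (integrableOn_BZ_of_norm_le_mul_norm_rpow_neg)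

variable {d : ℕ}

/-! ## §1 The zone -/

/-- `‖s‖_∞ ≤ π` on the zone `[-π,π]^d`. [folklore] -/
theorem norm_le_pi_of_mem_BZ {s : Fin d → ℝ} (hs : s ∈ BZ d) : ‖s‖ ≤ Real.pi := by
  rw [pi_norm_le_iff_of_nonneg Real.pi_pos.le]
  intro i
  rw [Real.norm_eq_abs, abs_le]
  exact ⟨hs.1 i, hs.2 i⟩

/-- the origin lies in the zone. [folklore] -/
theorem zero_mem_BZ : (0 : Fin d → ℝ) ∈ BZ d := by
  refine ⟨fun i => ?_, fun i => ?_⟩ <;> simp only [Pi.zero_apply] <;> linarith [Real.pi_pos]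

/-- the punctured zone and the zone agree almost everywhere (a point is Lebesgue-null in `ℝ^{d+1}`). [folklore] -/
theorem BZ_diff_zero_ae_eq : (BZ (d + 1) \ {0} : Set (Fin (d + 1) → ℝ)) =ᵐ[volume] BZ (d + 1) :=
  sdiff_null_ae_eq_self (measure_singleton (0 : Fin (d + 1) → ℝ))

/-! ## §2 Sup norm: `‖s‖^{-a} ∈ L¹(BZ (d+1))` for `a < d + 1` -/

/-- `s ↦ ‖s‖_∞^{-a}` is continuous off the origin. [folklore] -/
theorem continuousOn_norm_rpow_neg (a : ℝ) : ContinuousOn (fun s : Fin (d + 1) → ℝ => ‖s‖ ^ (-a)) (BZ (d + 1) \ {0}) := by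
  refine fun s hs => ContinuousAt.continuousWithinAt ?_
  exact continuous_norm.continuousAt.rpow_const (Or.inl (norm_ne_zero_iff.2 fun h => hs.2 h))

/-- **`‖s‖^{-a} ∈ L¹([-π,π]^{d+1})` for `a < d + 1`** (sup norm): leaf-05-g34's punctured-zone lemma
`PuncturedCoordDeriv.integrableOn_BZ_of_norm_le_mul_norm_rpow_neg` at `f := ‖·‖^{-a}`, `C := 1` (polar coordinates — Mathlib
`integrableOn_ball_of_norm_le_rpow` — inside). [folklore] -/
theorem integrableOn_norm_rpow_neg_BZ {a : ℝ} (ha : a < (d : ℝ) + 1) :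
    IntegrableOn (fun s : Fin (d + 1) → ℝ => ‖s‖ ^ (-a)) (BZ (d + 1)) :=
  integrableOn_BZ_of_norm_le_mul_norm_rpow_neg zero_le_one ha (continuousOn_norm_rpow_neg a) fun s _ _ => by
    rw [Real.norm_eq_abs, abs_of_nonneg (Real.rpow_nonneg (norm_nonneg _) _), one_mul]

/-- `‖s‖^{-(k:ℝ)} = (‖s‖^k)⁻¹` (also at `s = 0`, where both sides are `0` for `k ≥ 1` and `1` for `k = 0`). [folklore] -/
theorem norm_rpow_neg_natCast (s : Fin d → ℝ) (k : ℕ) : ‖s‖ ^ (-(k : ℝ)) = (‖s‖ ^ k)⁻¹ := by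
  rw [Real.rpow_neg (norm_nonneg _), Real.rpow_natCast]

/-- natural-power form: **`(‖s‖^k)⁻¹ ∈ L¹([-π,π]^{d+1})` for `k ≤ d`**. [folklore] -/
theorem integrableOn_inv_norm_pow_BZ {k : ℕ} (hk : k ≤ d) :
    IntegrableOn (fun s : Fin (d + 1) → ℝ => (‖s‖ ^ k)⁻¹) (BZ (d + 1)) := by
  have h := integrableOn_norm_rpow_neg_BZ (d := d) (a := k) (by exact_mod_cast Nat.lt_succ_of_le hk)
  exact h.congr_fun (fun s _ => norm_rpow_neg_natCast s k) measurableSet_BZ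

/-- road instance `d + 1 = 4`, `a = 1`: `‖s‖⁻¹ ∈ L¹(BZ 4)`. [folklore] -/
theorem integrableOn_inv_norm_BZ_four : IntegrableOn (fun s : Fin 4 → ℝ => ‖s‖⁻¹) (BZ 4) := by
  simpa only [pow_one] using integrableOn_inv_norm_pow_BZ (d := 3) (k := 1) (by norm_num)

/-- road instance `d + 1 = 4`, `a = 2`: `‖s‖⁻² ∈ L¹(BZ 4)` — the majorant `(π²/4)^{d+3}/‖s‖²` of the perfect propagator symbol
(`PerfectPropagatorBound.norm_PinfSym_d1Sym_le_inv_norm_sq`) is integrable. [folklore] -/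
theorem integrableOn_inv_norm_sq_BZ_four : IntegrableOn (fun s : Fin 4 → ℝ => (‖s‖ ^ 2)⁻¹) (BZ 4) :=
  integrableOn_inv_norm_pow_BZ (d := 3) (k := 2) (by norm_num)

/-- road instance `d + 1 = 4`, `a = 3`: `‖s‖⁻³ ∈ L¹(BZ 4)` — the letter of rows H2-P-KER ∕ H2-P-B (three integrations by parts). [folklore] -/
theorem integrableOn_inv_norm_cube_BZ_four : IntegrableOn (fun s : Fin 4 → ℝ => (‖s‖ ^ 3)⁻¹) (BZ 4) :=
  integrableOn_inv_norm_pow_BZ (d := 3) (k := 3) (by norm_num)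

/-- road instance, real-exponent spelling: `‖s‖^{-1} ∈ L¹(BZ 4)`. [folklore] -/
theorem integrableOn_norm_rpow_neg_one_BZ_four : IntegrableOn (fun s : Fin 4 → ℝ => ‖s‖ ^ (-1 : ℝ)) (BZ 4) :=
  integrableOn_norm_rpow_neg_BZ (d := 3) (a := 1) (by norm_num)

/-- road instance, real-exponent spelling: `‖s‖^{-2} ∈ L¹(BZ 4)`. [folklore] -/
theorem integrableOn_norm_rpow_neg_two_BZ_four : IntegrableOn (fun s : Fin 4 → ℝ => ‖s‖ ^ (-2 : ℝ)) (BZ 4) :=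
  integrableOn_norm_rpow_neg_BZ (d := 3) (a := 2) (by norm_num)

/-- road instance, real-exponent spelling: `‖s‖^{-3} ∈ L¹(BZ 4)`. [folklore] -/
theorem integrableOn_norm_rpow_neg_three_BZ_four : IntegrableOn (fun s : Fin 4 → ℝ => ‖s‖ ^ (-3 : ℝ)) (BZ 4) :=
  integrableOn_norm_rpow_neg_BZ (d := 3) (a := 3) (by norm_num)

/-! ## §3 Consumer form, natural powers (corollary of `PuncturedCoordDeriv` BY NAME) -/

variable {E : Type*} [NormedAddCommGroup E]

/-- natural-power form of leaf-05's consumer lemma: **continuous off the origin + `‖f s‖ ≤ C/‖s‖^k` on the punctured zone (`k ≤ d`, `0 ≤ C`) ⇒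
`f ∈ L¹(BZ (d+1))`** (`PuncturedCoordDeriv.integrableOn_BZ_of_norm_le_mul_norm_rpow_neg` at `α := k`). [folklore] -/
theorem integrableOn_BZ_of_norm_le_div_norm_pow {k : ℕ} (hk : k ≤ d) {C : ℝ} (hC : 0 ≤ C) {f : (Fin (d + 1) → ℝ) → E}
    (hf : ContinuousOn f (BZ (d + 1) \ {0})) (hle : ∀ s ∈ BZ (d + 1), s ≠ 0 → ‖f s‖ ≤ C / ‖s‖ ^ k) :
    IntegrableOn f (BZ (d + 1)) := by
  refine integrableOn_BZ_of_norm_le_mul_norm_rpow_neg hC (α := k) (by exact_mod_cast Nat.lt_succ_of_le hk) hf fun s hs h0 => ?_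
  rw [norm_rpow_neg_natCast, ← div_eq_mul_inv]
  exact hle s hs h0

/-! ## §4 Euclidean variant: `√(Σ_i s_i²)^{-a} ∈ L¹(BZ (d+1))` for `a < d + 1` -/

/-- each coordinate is dominated by the Euclidean radius: `|s_i| ≤ √(Σ_j s_j²)`. [folklore] -/
theorem abs_apply_le_euclid (s : Fin d → ℝ) (i : Fin d) : |s i| ≤ Real.sqrt (∑ j, s j ^ 2) := by
  rw [← Real.sqrt_sq_eq_abs]
  exact Real.sqrt_le_sqrt (Finset.single_le_sum (f := fun j => s j ^ 2) (fun j _ => sq_nonneg (s j)) (Finset.mem_univ i))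

/-- the sup norm is dominated by the Euclidean radius: `‖s‖_∞ ≤ √(Σ_i s_i²)`. [folklore] -/
theorem norm_le_euclid (s : Fin d → ℝ) : ‖s‖ ≤ Real.sqrt (∑ i, s i ^ 2) := by
  rw [pi_norm_le_iff_of_nonneg (Real.sqrt_nonneg _)]
  intro i
  rw [Real.norm_eq_abs]
  exact abs_apply_le_euclid s i

/-- … and dominates it up to `√d`: `√(Σ_i s_i²) ≤ √d·‖s‖_∞`. [folklore] -/
theorem euclid_le_sqrt_card_mul_norm (s : Fin d → ℝ) : Real.sqrt (∑ i, s i ^ 2) ≤ Real.sqrt d * ‖s‖ := by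
  have h : ∑ i, s i ^ 2 ≤ d * ‖s‖ ^ 2 := by
    calc ∑ i, s i ^ 2 ≤ ∑ _i : Fin d, ‖s‖ ^ 2 := Finset.sum_le_sum fun i _ => by
            rw [← sq_abs]; exact pow_le_pow_left₀ (abs_nonneg _) (by simpa using norm_le_pi_norm s i) 2
      _ = d * ‖s‖ ^ 2 := by simp
  calc Real.sqrt (∑ i, s i ^ 2) ≤ Real.sqrt (d * ‖s‖ ^ 2) := Real.sqrt_le_sqrt h
    _ = Real.sqrt d * ‖s‖ := by rw [Real.sqrt_mul (Nat.cast_nonneg d), Real.sqrt_sq (norm_nonneg _)]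

/-- the Euclidean radius vanishes only at the origin. [folklore] -/
theorem euclid_pos {s : Fin d → ℝ} (h0 : s ≠ 0) : 0 < Real.sqrt (∑ i, s i ^ 2) :=
  lt_of_lt_of_le (norm_pos_iff.2 h0) (norm_le_euclid s)

/-- the Euclidean radius is continuous. [folklore] -/
theorem continuous_euclid : Continuous fun s : Fin d → ℝ => Real.sqrt (∑ i, s i ^ 2) := by
  fun_prop

/-- **`√(Σ_i s_i²)^{-a} ∈ L¹([-π,π]^{d+1})` for `a < d + 1`**: for `0 ≤ a` leaf-05's lemma with the majorant `√Σ^{-a} ≤ ‖s‖_∞^{-a}`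
(`‖s‖_∞ ≤ √Σ`), for `a < 0` continuity on the compact zone. [folklore] -/
theorem integrableOn_euclid_rpow_neg_BZ {a : ℝ} (ha : a < (d : ℝ) + 1) :
    IntegrableOn (fun s : Fin (d + 1) → ℝ => Real.sqrt (∑ i, s i ^ 2) ^ (-a)) (BZ (d + 1)) := by
  rcases le_or_gt 0 a with ha0 | ha0
  · refine integrableOn_BZ_of_norm_le_mul_norm_rpow_neg zero_le_one ha
      (continuous_euclid.continuousOn.rpow_const fun s hs => Or.inl (euclid_pos fun h => hs.2 h).ne') fun s _ h0 => ?_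
    rw [Real.norm_eq_abs, abs_of_nonneg (Real.rpow_nonneg (Real.sqrt_nonneg _) _), one_mul]
    exact Real.rpow_le_rpow_of_nonpos (norm_pos_iff.2 h0) (norm_le_euclid s) (by linarith)
  · refine ContinuousOn.integrableOn_compact isCompact_BZ (Continuous.continuousOn ?_)
    exact continuous_euclid.rpow_const fun s => Or.inr (by linarith)

/-- `√(Σ)^{-(k:ℝ)} = (√(Σ)^k)⁻¹`. [folklore] -/
theorem euclid_rpow_neg_natCast (s : Fin d → ℝ) (k : ℕ) :
    Real.sqrt (∑ i, s i ^ 2) ^ (-(k : ℝ)) = (Real.sqrt (∑ i, s i ^ 2) ^ k)⁻¹ := by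
  rw [Real.rpow_neg (Real.sqrt_nonneg _), Real.rpow_natCast]

/-- natural-power form: **`(√(Σ_i s_i²)^k)⁻¹ ∈ L¹([-π,π]^{d+1})` for `k ≤ d`**. [folklore] -/
theorem integrableOn_inv_euclid_pow_BZ {k : ℕ} (hk : k ≤ d) :
    IntegrableOn (fun s : Fin (d + 1) → ℝ => (Real.sqrt (∑ i, s i ^ 2) ^ k)⁻¹) (BZ (d + 1)) := by
  have h := integrableOn_euclid_rpow_neg_BZ (d := d) (a := k) (by exact_mod_cast Nat.lt_succ_of_le hk)
  exact h.congr_fun (fun s _ => euclid_rpow_neg_natCast s k) measurableSet_BZ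

/-- road instance `d + 1 = 4`, `a = 1`: `(√Σ_i s_i²)⁻¹ ∈ L¹(BZ 4)`. [folklore] -/
theorem integrableOn_inv_euclid_BZ_four : IntegrableOn (fun s : Fin 4 → ℝ => (Real.sqrt (∑ i, s i ^ 2))⁻¹) (BZ 4) := by
  simpa only [pow_one] using integrableOn_inv_euclid_pow_BZ (d := 3) (k := 1) (by norm_num)

/-- road instance `d + 1 = 4`, `a = 2`: `(Σ_i s_i²)⁻¹ ∈ L¹(BZ 4)` (`(√Σ)² = Σ`). [folklore] -/
theorem integrableOn_inv_sum_sq_BZ_four : IntegrableOn (fun s : Fin 4 → ℝ => (∑ i, s i ^ 2)⁻¹) (BZ 4) := by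
  have h := integrableOn_inv_euclid_pow_BZ (d := 3) (k := 2) (by norm_num)
  refine h.congr_fun (fun s _ => ?_) measurableSet_BZ
  dsimp only
  rw [Real.sq_sqrt (Finset.sum_nonneg fun i _ => sq_nonneg (s i))]

/-- road instance `d + 1 = 4`, `a = 3`: `(√Σ_i s_i²)⁻³ ∈ L¹(BZ 4)`. [folklore] -/
theorem integrableOn_inv_euclid_cube_BZ_four : IntegrableOn (fun s : Fin 4 → ℝ => (Real.sqrt (∑ i, s i ^ 2) ^ 3)⁻¹) (BZ 4) :=
  integrableOn_inv_euclid_pow_BZ (d := 3) (k := 3) (by norm_num)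

/-- consumer form, Euclidean: **continuous off the origin + `‖f s‖ ≤ C/√(Σ_i s_i²)^k` on the punctured zone (`k ≤ d`, `0 ≤ C`) ⇒
`f ∈ L¹(BZ (d+1))`** (`‖s‖_∞ ≤ √Σ` turns the Euclidean majorant into the sup-norm one of §3). [folklore] -/
theorem integrableOn_BZ_of_norm_le_div_euclid_pow {k : ℕ} (hk : k ≤ d) {C : ℝ} (hC : 0 ≤ C)
    {f : (Fin (d + 1) → ℝ) → E} (hf : ContinuousOn f (BZ (d + 1) \ {0}))
    (hle : ∀ s ∈ BZ (d + 1), s ≠ 0 → ‖f s‖ ≤ C / Real.sqrt (∑ i, s i ^ 2) ^ k) :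
    IntegrableOn f (BZ (d + 1)) := by
  refine integrableOn_BZ_of_norm_le_div_norm_pow hk hC hf fun s hs h0 => (hle s hs h0).trans ?_
  have hn : 0 < ‖s‖ := norm_pos_iff.2 h0
  exact div_le_div_of_nonneg_left hC (pow_pos hn k) (pow_le_pow_left₀ hn.le (norm_le_euclid s) k)

end Summit.QuantumFields.BalabanUV.Beta.FP.BrillouinRadial

end
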